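import Literature.NumberTheory.LFunctions.ExplicitDeuringHeilbronnDirichlet
import Mathlib.MeasureTheory.Integral.IntervalIntegral.Basic
import HarnessLib

/-!
# The repulsive log-free zero-density estimate for a single modulus and the uniform prime
# number theorem for arithmetic progressions with the Siegel correction
# (Thorner–Zaman, *Math. Z.* 306 (2024): Theorem 7, Lemma 13, Theorem 1, Corollary 5)

Topic `Literature/NumberTheory/LFunctions` (namespace `Literature.NumberTheory.LFunctions`, paper
sub-namespace `ThornerZaman2024PNTAP`). STATEMENT LAYER (D-0014/D-0064: one file for the paper's
§§1–2 statements), typed for the cell `landau-siegel` (rung F-S3, sub-cell C harvest, reader r3,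
rows r3-T06/T07 of `pub/landau-siegel/lit/r3/ROWS.md`; design family B-dh «explicit
Deuring–Heilbronn / log-free zero-density hybrids»). NAMED FACTS (closed `Prop`s with their cites),
not proved here; plus elementary bookkeeping that IS proved (`nu_nonneg`, `nu_le_one`,
`charZeroCountGeExcl_le`, `repulsive_rhs_le`).

Source: J. Thorner, A. Zaman, *Refinements to the prime number theorem for arithmetic
progressions*, Math. Z. **306** (2024), no. 3, doi:10.1007/s00209-023-03414-3 = arXiv:2108.10878
[ThornerZaman2024PNTAP], read on the held copy `paper:arxiv-2108.10878` (§1 pp. 3–4, §2 p. 6,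
§4 Lemma 13 p. 10, §5 Remark 21 p. 15).

## VERSION NOTE / ERRATUM OF PROVENANCE (2026-08-27, cell `landau-siegel` §C r3)

The held copy, and therefore every quotation, locator and numerical exponent in this file, is
**arXiv:2108.10878v1 (24 Aug 2021)**. The source has a second arXiv version, **v2 (21 Sep 2021, the
last public preprint)**, read on its TeX source, which changes three of the displays typed below;
the journal version (Math. Z. **306** (2024), Paper 54, 14 pp.) is NOT held (acquisition request
acq-12185) and is expected to follow v2. The v2 statements, each of which IMPLIES the v1 statement
typed here (so the named facts below are weaker-than-v2 paraphrases, not over-claims, provided the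
journal agrees with v2):
* Theorem 7, repulsive part: v2 prints `N_q*(σ,T) ≪_ε ν(qT)(qT)^{(37/5+ε)(1−σ)}` for `T ≥ 1`,
  `q ≥ 2`, `0 ≤ σ ≤ 1`, proved in twelve lines from the unconditional `(12/5+ε)`-density
  (Huxley–Jutila) and the Deuring–Heilbronn inequality — the Petrow–Young §5, (5.14) and Remark 21
  quoted below exist in v1 only. Since `qT ≥ 1`, for any fixed `ε` the v2 bound implies
  `N_q*(σ,T) ≤ C ν(qT)(qT)^{(75/4)(1−σ)}` = `thornerZaman2024PNTAP_theorem7_repulsive`.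
* Theorem 1: v2 has `θ := 32/37` if `(β₁,χ₁)` exists (`7/12` otherwise, unchanged); since
  `x^{71/75+ε} ≥ x^{32/37+ε}` and `1 − 71/75 < 1 − 32/37`, v2 implies
  `thornerZaman2024PNTAP_theorem1_exceptional` as typed (Remark 4's "`71/75` … limit of our method"
  is v1 wording).
* Corollary 5 (long intervals): v2's hypothesis is "`x ≥ q^{12}`" in place of v1's "`x ≥ 3` and
  `λx/φ(q) ≥ x^{18/19}`" (same conclusion, absolute constants); as `λ < 2`, the v1 hypothesis forces
  `φ(q) < 2x^{1/19}`, hence `x ≥ q^{12}` for all `q ≥ 44`, the finitely many remaining `(q,x)` being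
  absorbed by the existential constant `K` — so v2 implies `thornerZaman2024PNTAP_corollary5_regular`
  and `_exceptional` as typed.
* Unchanged in v2: the unconditional `(12/5+ε)` part of Theorem 7 (v2 adds `q ≥ 2`), Lemma 13 =
  the `λ`-size lemma (`4 ≤ x^{1/2} ≤ h ≤ x ⇒ (1/8)min{1,(1−β₁)log x} < λ < 2`; the discharged
  `thornerZaman2024PNTAP_lemma13`), the shape of the error terms.
No declaration is changed by this note; a statement-level revision waits for the journal pages.

## What the source prints (verbatim where it matters)

§1: "McCurley proved that `∏_{χ (mod q)} L(s,χ)` has at most one real zero `β₁ ≥ 1 − 1/(50 log q)`.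
If this exceptional zero `β₁` exists, then it is simple, and there exists a unique nontrivial real
Dirichlet character `χ₁ (mod q)` such that `L(β₁,χ₁) = 0`. We paraphrase this with
'`(β₁,χ₁)` exists'." **Theorem 1.** "Let `q ≥ 2` and `a` be coprime integers, and let
`4 ≤ h ≤ x`. Define `λ = λ(x,q,a,h)` and `θ` by `λ := (1/h)∫_{x−h}^x (1 − χ₁(a) t^{β₁−1}) dt` if
`(β₁,χ₁)` exists, `1` otherwise, and `θ := 71/75` if `(β₁,χ₁)` exists, `7/12` otherwise. For all
`0 < ε < 1 − θ`, there is a constant `c₁ = c₁(ε) > 0` such that if `λh/φ(q) ≥ x^{θ+ε}`, then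
`∑_{x−h<p≤x, p≡a (mod q)} log p = (λh/φ(q))[1 + O_ε(exp(−c₁ log x/(log q + (log(x/h))^{2/3}
(log⁺log(x/h))^{1/3} + (log x)^{2/5}(log log x)^{1/5})))]`. The implied constant and `c₁` are
effectively computable, and `log⁺(u) = max{0, log u}`." (1.7): "`(1/8) min{1,(1−β₁) log x} < λ < 2`,
which we prove in Section 4" = **Lemma 13.** "If `(β₁,χ₁)` exists, `4 ≤ h ≤ x`, and `x^{1/2} ≤ h ≤ x`,
then `(1/8) min{1,(1−β₁) log x} < λ < 2`." **Corollary 5.** "Let `q ≥ 2` and `a` be coprime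
integers and `x ≥ 3`. Let `λ = λ(x,q,a,x)` be as in Theorem 1. There exists a constant `c₂ > 0`
such that if `λx/φ(q) ≥ x^{18/19}`, then `∑_{p≤x, p≡a (mod q)} log p = (λx/φ(q))[1 + O(exp(−c₂
log x/log q) + exp(−c₂ (log x)^{3/5}/(log log x)^{1/5}))]`. The implied constant and `c₂` are
absolute and effectively computable." (Remark 6: "If `(β₁,χ₁)` exists, then
`λ(x,q,a,x) = 1 − χ₁(a) x^{β₁−1}/β₁`.")
§2: "Let `q ≥ 2`, `T ≥ 1` and `0 ≤ σ ≤ 1`. For all Dirichlet characters `χ (mod q)`, we define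
`N_χ(σ,T) := |{ρ = β+iγ : β,γ ∈ ℝ, β ≥ σ, |γ| ≤ T, L(ρ,χ) = 0}|`. If `(β₁,χ₁)` exists, then we
define `N*_{χ₁}(σ,T) := |{ρ = β+iγ : β ≥ σ, |γ| ≤ T, ρ ≠ β₁, L(ρ,χ) = 0}|`. Let
`N_q(σ,T) := ∑_{χ (mod q)} N_χ(σ,T)`. If `(β₁,χ₁)` exists, then let
`N_q*(σ,T) := ∑_{χ ≠ χ₁} N_χ(σ,T) + N*_{χ₁}(σ,T)`." **Theorem 7.** "Let `ε > 0`. Let `q, T ≥ 1` and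
`0 ≤ σ ≤ 1`. We have the unconditional bound `N_q(σ,T) ≪_ε (qT)^{(12/5+ε)(1−σ)}`. If `(β₁,χ₁)`
exists and `ν(u) := min{1,(1−β₁) log u}`, then `N_q*(σ,T) ≪ ν(qT)(qT)^{(75/4)(1−σ)}`." (All implied
constants effective; the exponent `75/4` rounds `112.2056… × φ`, `φ = 1/6 + 10⁻⁷` the hybrid Weyl
subconvexity exponent of Petrow–Young, §5 (5.14) and Remark 21: "nearly the limit of this
approach".) **Remark 9.** "If `(β₁,χ₁)` exists (resp. does not exist) and the exponent `75/4`
(resp. `12/5`) is improved to some constant `c > 0`, then Theorem 8 holds with `θ = 1 − 1/c`."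

## Lean rendering / design choices

* `L(s,χ) = DirichletCharacter.LFunction χ s` (Mathlib) for EVERY `χ (mod q)` (principal and
  imprimitive included, as in the source's `∏_{χ (mod q)}`). `N_χ(σ,T)` is rendered literally as
  the cardinality `Set.ncard` of the printed set of zeros (the source writes `|{…}|`; that the proof
  counts multiplicities is not claimed in print and is not claimed here). For the principal
  character `L(s,χ₀) = ζ(s)∏_{p∣q}(1 − p^{−s})` Mathlib assigns a finite junk value at the pole
  `s = 1`; a zero there is impossible for `q ≥ 1` in print and immaterial to an upper bound.
* "`(β₁,χ₁)` exists" is the predicate `ExceptionalPair χ₁ β₁`: `χ₁ ≠ 1`, `χ₁` real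
  (`MulChar.IsQuadratic`, values in `{0, ±1}`), `1 − 1/(50 log q) ≤ β₁ < 1`, `L(β₁,χ₁) = 0`
  (`β₁ < 1` is automatic for a zero of a non-principal `L` and keeps the statement honest). The
  source's uniqueness of the pair (McCurley) is not needed to STATE Theorem 7: the bound is
  asserted for every such pair, which is what print says once the pair is unique.
* `χ₁(a) ∈ {1, −1}` for `(a,q) = 1` is written `(χ₁ a).re` (as in the tree's
  `PagePNTWithExceptionalZero`), `a : ZMod q` with `IsUnit a` ("`q` and `a` coprime").
* `∑_{x−h<p≤x, p≡a (q)} log p` is `thetaShortAP q a x h`, a `Finset` sum over the primes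
  `p ∈ (⌊x−h⌋, ⌊x⌋]` with `(p : ZMod q) = a` (for `0 ≤ x − h` and integers `p` this is exactly
  `x − h < p ≤ x`).
* "`A = B[1 + O_ε(E)]` with implied constant `K`" is `|A − B| ≤ K·B·E` (here `B = λh/φ(q) > 0`).
* Theorem 1 and Corollary 5 are each split into the two printed cases ("`(β₁,χ₁)` exists" /
  "otherwise") as two named facts with their own effective constants; print's single pair
  `(c₁(ε), O_ε)` is recovered by taking the min / max of the two.
* Theorem 7 is typed with `∃ C` constants ("`≪_ε`", "`≪`" with effective absolute constants, not
  given numerically in print) — the EXPONENTS `12/5 + ε` and `75/4` are the printed content.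

WHAT THIS IS NOT: no claim about Landau–Siegel zeros; nothing here is proved about `N_q`; the tree's
PROVED inexplicit forms are `LFDSingle.logFreeDensity_single` (Heath-Brown's Lemma 11.1, one
character, inexplicit exponent) and `LogFreeDensity.logFreeDensityDH` (Bombieri's Théorème 14 with
the factor `(1 − β₁) log T`, family `q ≤ T`); the EXPLICIT family forms are the named facts
`thornerZaman2024_theorem12` / `thornerZaman2024_corollary61` (exponents `99/170`, `127/198`); the
explicit single-modulus REPULSION is `BGTZ2025.corollary11`; Page's PNT with the `x^{β₁}/β₁` term in
the classical range is `PagePNTWithExceptionalZero`; Huxley's `12/5` WITH logarithms is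
`HuxleyZeroDensity.lean`. None of these is restated. No instance, no notation.

«The programme SEARCHES and TYPES; no claim about Landau–Siegel zeros, Theorems 1–2 of
arXiv:2211.02515 or a repaired Margin232 until a kernel theorem says so.»

## References

* [ThornerZaman2024PNTAP] J. Thorner, A. Zaman, Math. Z. 306 (2024), doi:10.1007/s00209-023-03414-3,
  arXiv:2108.10878 — Theorem 1, (1.7)/Lemma 13, Corollary 5, Remark 6, Theorem 7, Remarks 9 and 21.
* [McCurley1984ZFR] K. S. McCurley, Math. Comp. 42 (1984) — the `1 − 1/(50 log q)` window (as quoted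
  in the source's §1; tree: `McCurley1984_theorem1`).
* [PetrowYoung2023] I. Petrow, M. P. Young — the hybrid Weyl bound behind `75/4` (source §5).
-/

noncomputable section

open scoped Classical

namespace Literature.NumberTheory.LFunctions

namespace ThornerZaman2024PNTAP

/-! ### The printed objects of §2 -/

/-- The printed zero set of `L(s,χ)` in `β ≥ σ`, `|γ| ≤ T`:
`{ρ = β+iγ : β ≥ σ, |γ| ≤ T, L(ρ,χ) = 0}`. [cite: ThornerZaman2024PNTAP, §2 (display defining N_χ(σ,T)) p.6] -/
def zeroSetGe {q : ℕ} [NeZero q] (χ : DirichletCharacter ℂ q) (σ T : ℝ) : Set ℂ :=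
  {ρ | χ.LFunction ρ = 0 ∧ σ ≤ ρ.re ∧ |ρ.im| ≤ T}

/-- `N_χ(σ,T) := |{ρ = β+iγ : β ≥ σ, |γ| ≤ T, L(ρ,χ) = 0}|`, as printed (a set cardinality,
`Set.ncard`). [cite: ThornerZaman2024PNTAP, §2 (display defining N_χ(σ,T)) p.6] -/
def charZeroCountGe {q : ℕ} [NeZero q] (χ : DirichletCharacter ℂ q) (σ T : ℝ) : ℕ :=
  (zeroSetGe χ σ T).ncard

/-- `N*_{χ₁}(σ,T) := |{ρ = β+iγ : β ≥ σ, |γ| ≤ T, ρ ≠ β₁, L(ρ,χ₁) = 0}|` — the count with the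
exceptional zero removed. [cite: ThornerZaman2024PNTAP, §2 (display defining N*_{χ₁}(σ,T)) p.6] -/
def charZeroCountGeExcl {q : ℕ} [NeZero q] (χ₁ : DirichletCharacter ℂ q) (β₁ σ T : ℝ) : ℕ :=
  (zeroSetGe χ₁ σ T \ {((β₁ : ℝ) : ℂ)}).ncard

/-- `N_q(σ,T) := ∑_{χ (mod q)} N_χ(σ,T)`. [cite: ThornerZaman2024PNTAP, §2 (display defining N_q(σ,T)) p.6] -/
def modZeroCount (q : ℕ) [NeZero q] (σ T : ℝ) : ℕ :=
  ∑ χ : DirichletCharacter ℂ q, charZeroCountGe χ σ T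

/-- `N_q*(σ,T) := ∑_{χ ≠ χ₁} N_χ(σ,T) + N*_{χ₁}(σ,T)` (relative to the exceptional pair `(β₁,χ₁)`).
[cite: ThornerZaman2024PNTAP, §2 (display defining N_q*(σ,T)) p.6] -/
def modZeroCountExcl {q : ℕ} [NeZero q] (χ₁ : DirichletCharacter ℂ q) (β₁ σ T : ℝ) : ℕ :=
  (∑ χ : DirichletCharacter ℂ q, if χ = χ₁ then 0 else charZeroCountGe χ σ T) +
    charZeroCountGeExcl χ₁ β₁ σ T

/-- "`(β₁,χ₁)` exists": `χ₁ (mod q)` is a nontrivial real Dirichlet character and `β₁` is a real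
zero of `L(s,χ₁)` with `β₁ ≥ 1 − 1/(50 log q)` (McCurley's window, as quoted in §1; `β₁ < 1` is
automatic for a zero of a non-principal `L`-function and is recorded for convenience).
[cite: ThornerZaman2024PNTAP, §1 (paragraph before Theorem 1) p.3] -/
def ExceptionalPair {q : ℕ} [NeZero q] (χ₁ : DirichletCharacter ℂ q) (β₁ : ℝ) : Prop :=
  χ₁ ≠ 1 ∧ χ₁.IsQuadratic ∧ 1 - 1 / (50 * Real.log q) ≤ β₁ ∧ β₁ < 1 ∧ χ₁.LFunction β₁ = 0

/-- `ν(u) := min{1, (1 − β₁) log u}` — the Deuring–Heilbronn (Bombieri) repulsion factor.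
[cite: ThornerZaman2024PNTAP, Theorem 7 p.6] -/
def nu (β₁ u : ℝ) : ℝ :=
  min 1 ((1 - β₁) * Real.log u)

/-! ### The printed objects of §1 -/

/-- `∑_{x−h < p ≤ x, p ≡ a (mod q)} log p` for real `4 ≤ h ≤ x`: the sum of `log p` over the primes
`p ∈ (⌊x−h⌋, ⌊x⌋]` (= the integers with `x − h < p ≤ x`, since `x − h ≥ 0`) with `p ≡ a (mod q)`.
[cite: ThornerZaman2024PNTAP, Theorem 1 p.3] -/
def thetaShortAP (q : ℕ) (a : ZMod q) (x h : ℝ) : ℝ :=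
  ∑ p ∈ (Finset.Ioc ⌊x - h⌋₊ ⌊x⌋₊).filter (fun p => p.Prime ∧ ((p : ℕ) : ZMod q) = a),
    Real.log p

/-- `λ(x,q,a,h) := (1/h) ∫_{x−h}^{x} (1 − χ₁(a) t^{β₁−1}) dt` in the case "`(β₁,χ₁)` exists"
(`χ₁(a) = (χ₁ a).re ∈ {1,−1}` for `(a,q) = 1`). In the other case print sets `λ = 1`.
[cite: ThornerZaman2024PNTAP, Theorem 1 (definition of λ) p.3] -/
def lambdaExc {q : ℕ} [NeZero q] (χ₁ : DirichletCharacter ℂ q) (β₁ : ℝ) (a : ZMod q) (x h : ℝ) : ℝ :=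
  (1 / h) * ∫ t in (x - h)..x, (1 - (χ₁ a).re * t ^ (β₁ - 1))

/-- The denominator of the exponent in Theorem 1's error term:
`log q + (log(x/h))^{2/3}(log⁺ log(x/h))^{1/3} + (log x)^{2/5}(log log x)^{1/5}`,
`log⁺ u = max{0, log u}`. [cite: ThornerZaman2024PNTAP, Theorem 1 p.3] -/
def errDenom (q : ℕ) (x h : ℝ) : ℝ :=
  Real.log q + Real.log (x / h) ^ ((2 : ℝ) / 3) * (max 0 (Real.log (Real.log (x / h)))) ^ ((1 : ℝ) / 3) +
    Real.log x ^ ((2 : ℝ) / 5) * Real.log (Real.log x) ^ ((1 : ℝ) / 5)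

end ThornerZaman2024PNTAP

open ThornerZaman2024PNTAP

/-! ### Theorem 7 — the log-free zero-density estimates for one modulus -/

/-- **Thorner–Zaman (Math. Z. 2024), Theorem 7, first part (NAMED FACT, as printed):
the unconditional single-modulus log-free zero-density estimate with Huxley's exponent.**
"Let `ε > 0`. Let `q, T ≥ 1` and `0 ≤ σ ≤ 1`. We have the unconditional bound
`N_q(σ,T) ≪_ε (qT)^{(12/5+ε)(1−σ)}`" (effective implied constant depending on `ε` only).
Not proved here. [cite: ThornerZaman2024PNTAP, Theorem 7 (first display) p.6] -/
def thornerZaman2024PNTAP_theorem7_unconditional : Prop :=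
  ∀ ε : ℝ, 0 < ε → ∃ C : ℝ, 0 < C ∧
    ∀ (q : ℕ) [NeZero q] (T σ : ℝ), 1 ≤ T → 0 ≤ σ → σ ≤ 1 →
      (modZeroCount q σ T : ℝ) ≤ C * ((q : ℝ) * T) ^ ((12 / 5 + ε) * (1 - σ))

/-- **Thorner–Zaman (Math. Z. 2024), Theorem 7, second part (NAMED FACT, as printed):
the REPULSIVE log-free zero-density estimate for one modulus.** "If `(β₁,χ₁)` exists and
`ν(u) := min{1,(1−β₁) log u}`, then `N_q*(σ,T) ≪ ν(qT)(qT)^{(75/4)(1−σ)}`" for `q, T ≥ 1`,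
`0 ≤ σ ≤ 1` (absolute effective implied constant; `75/4` = Petrow–Young's Weyl exponent
`φ = 1/6 + 10⁻⁷` times `112.2056…`, §5 (5.14); Remark 21: "nearly the limit of this approach").
A Landau–Siegel zero `β₁` very close to `1` SHRINKS the count of all other zeros of
`∏_{χ (mod q)} L(s,χ)` by the factor `(1 − β₁) log(qT)`. Not proved here. VERSION NOTE: the
exponent `75/4` and the absolute constant are arXiv v1; arXiv v2 prints
`≪_ε ν(qT)(qT)^{(37/5+ε)(1−σ)}`, which implies this statement (module docstring).
[cite: ThornerZaman2024PNTAP, Theorem 7 (second display) p.6 (arXiv v1); arXiv v2 Theorem 7] -/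
def thornerZaman2024PNTAP_theorem7_repulsive : Prop :=
  ∃ C : ℝ, 0 < C ∧
    ∀ (q : ℕ) [NeZero q] (χ₁ : DirichletCharacter ℂ q) (β₁ : ℝ), ExceptionalPair χ₁ β₁ →
      ∀ (T σ : ℝ), 1 ≤ T → 0 ≤ σ → σ ≤ 1 →
        (modZeroCountExcl χ₁ β₁ σ T : ℝ) ≤
          C * nu β₁ ((q : ℝ) * T) * ((q : ℝ) * T) ^ ((75 : ℝ) / 4 * (1 - σ))

/-! ### Lemma 13 — the size of `λ` -/

/-- **Thorner–Zaman (Math. Z. 2024), Lemma 13 = (1.7) (NAMED FACT, as printed).** "If `(β₁,χ₁)`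
exists, `4 ≤ h ≤ x`, and `x^{1/2} ≤ h ≤ x`, then `(1/8) min{1,(1−β₁) log x} < λ < 2`"
(`q ≥ 2`, `(a,q) = 1` from the standing hypotheses of §1). Elementary (mean value theorem and the
Taylor expansion of `t/(1 − e^{−t})`), not proved here. [cite: ThornerZaman2024PNTAP, Lemma 13 p.10] -/
def thornerZaman2024PNTAP_lemma13 : Prop :=
  ∀ (q : ℕ) [NeZero q], 2 ≤ q → ∀ (χ₁ : DirichletCharacter ℂ q) (β₁ : ℝ), ExceptionalPair χ₁ β₁ →
    ∀ (a : ZMod q), IsUnit a → ∀ (x h : ℝ), 4 ≤ h → Real.sqrt x ≤ h → h ≤ x →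
      1 / 8 * nu β₁ x < lambdaExc χ₁ β₁ a x h ∧ lambdaExc χ₁ β₁ a x h < 2

/-! ### Theorem 1 — the uniform prime number theorem for arithmetic progressions -/

/-- **Thorner–Zaman (Math. Z. 2024), Theorem 1, case "`(β₁,χ₁)` does not exist" (NAMED FACT, as
printed; `λ = 1`, `θ = 7/12`).** For all `0 < ε < 1 − 7/12` there are effective `c > 0` and
`K ≥ 0` (depending on `ε` only) such that for all coprime `q ≥ 2`, `a`, all `4 ≤ h ≤ x` with NO
exceptional pair modulo `q` and `h/φ(q) ≥ x^{7/12+ε}`: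
`|∑_{x−h<p≤x, p≡a} log p − h/φ(q)| ≤ K (h/φ(q)) exp(−c log x/(log q + (log(x/h))^{2/3}(log⁺log(x/h))^{1/3} + (log x)^{2/5}(log log x)^{1/5}))`.
Not proved here. [cite: ThornerZaman2024PNTAP, Theorem 1 p.3] -/
def thornerZaman2024PNTAP_theorem1_regular : Prop :=
  ∀ ε : ℝ, 0 < ε → ε < 1 - 7 / 12 → ∃ c : ℝ, 0 < c ∧ ∃ K : ℝ, 0 ≤ K ∧
    ∀ (q : ℕ) [NeZero q], 2 ≤ q → (∀ (χ₁ : DirichletCharacter ℂ q) (β₁ : ℝ), ¬ ExceptionalPair χ₁ β₁) →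
      ∀ (a : ZMod q), IsUnit a → ∀ (x h : ℝ), 4 ≤ h → h ≤ x →
        x ^ (7 / 12 + ε) ≤ h / Nat.totient q →
          |thetaShortAP q a x h - h / Nat.totient q| ≤
            K * (h / Nat.totient q) * Real.exp (-c * Real.log x / errDenom q x h)

/-- **Thorner–Zaman (Math. Z. 2024), Theorem 1, case "`(β₁,χ₁)` exists" (NAMED FACT, as printed;
`λ = (1/h)∫_{x−h}^x (1 − χ₁(a)t^{β₁−1}) dt`, `θ = 71/75`).** For all `0 < ε < 1 − 71/75` there are
effective `c > 0` and `K ≥ 0` (depending on `ε` only) such that for all `q ≥ 2`, every exceptional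
pair `(β₁,χ₁)` modulo `q`, all `(a,q) = 1`, all `4 ≤ h ≤ x` with `λh/φ(q) ≥ x^{71/75+ε}`:
`|∑_{x−h<p≤x, p≡a} log p − λh/φ(q)| ≤ K (λh/φ(q)) exp(−c log x/(log q + (log(x/h))^{2/3}(log⁺log(x/h))^{1/3} + (log x)^{2/5}(log log x)^{1/5}))`
— the Siegel correction `−χ₁(a)(x^{β₁} − (x−h)^{β₁})/(β₁φ(q))` carried as a "secondary main term"
((1.4)), effective and uniform in `q, a, h, x`. Remark 4: "`71/75` … Without assuming bounds for
Dirichlet `L`-functions beyond the recently proven hybrid Weyl bound, this appears to be the limit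
of our method when `(β₁,χ₁)` exists." Not proved here. VERSION NOTE: `θ = 71/75` and Remark 4 are
arXiv v1; arXiv v2 prints `θ = 32/37`, which implies this statement (module docstring).
[cite: ThornerZaman2024PNTAP, Theorem 1 p.3 (arXiv v1); arXiv v2 Theorem 1] -/
def thornerZaman2024PNTAP_theorem1_exceptional : Prop :=
  ∀ ε : ℝ, 0 < ε → ε < 1 - 71 / 75 → ∃ c : ℝ, 0 < c ∧ ∃ K : ℝ, 0 ≤ K ∧
    ∀ (q : ℕ) [NeZero q], 2 ≤ q → ∀ (χ₁ : DirichletCharacter ℂ q) (β₁ : ℝ), ExceptionalPair χ₁ β₁ →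
      ∀ (a : ZMod q), IsUnit a → ∀ (x h : ℝ), 4 ≤ h → h ≤ x →
        x ^ (71 / 75 + ε) ≤ lambdaExc χ₁ β₁ a x h * h / Nat.totient q →
          |thetaShortAP q a x h - lambdaExc χ₁ β₁ a x h * h / Nat.totient q| ≤
            K * (lambdaExc χ₁ β₁ a x h * h / Nat.totient q) *
              Real.exp (-c * Real.log x / errDenom q x h)

/-! ### Corollary 5 — long intervals (`h = x`) -/

/-- **Thorner–Zaman (Math. Z. 2024), Corollary 5, case "`(β₁,χ₁)` does not exist" (NAMED FACT,
as printed; `λ = 1`).** There are absolute effective `c > 0`, `K ≥ 0` such that for coprime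
`q ≥ 2`, `a`, `x ≥ 3` with no exceptional pair modulo `q` and `x/φ(q) ≥ x^{18/19}`:
`|∑_{p≤x, p≡a} log p − x/φ(q)| ≤ K (x/φ(q)) (exp(−c log x/log q) + exp(−c (log x)^{3/5}(log log x)^{−1/5}))`.
Not proved here. VERSION NOTE: the hypothesis `x ≥ 3 ∧ x/φ(q) ≥ x^{18/19}` is arXiv v1; arXiv v2
states the corollary under `x ≥ q^{12}`, which implies this statement (module docstring).
[cite: ThornerZaman2024PNTAP, Corollary 5 p.4 (arXiv v1); arXiv v2, Corollary (long intervals)] -/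
def thornerZaman2024PNTAP_corollary5_regular : Prop :=
  ∃ c : ℝ, 0 < c ∧ ∃ K : ℝ, 0 ≤ K ∧
    ∀ (q : ℕ) [NeZero q], 2 ≤ q → (∀ (χ₁ : DirichletCharacter ℂ q) (β₁ : ℝ), ¬ ExceptionalPair χ₁ β₁) →
      ∀ (a : ZMod q), IsUnit a → ∀ x : ℝ, 3 ≤ x → x ^ ((18 : ℝ) / 19) ≤ x / Nat.totient q →
        |thetaShortAP q a x x - x / Nat.totient q| ≤
          K * (x / Nat.totient q) *
            (Real.exp (-c * Real.log x / Real.log q) +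
              Real.exp (-c * Real.log x ^ ((3 : ℝ) / 5) / Real.log (Real.log x) ^ ((1 : ℝ) / 5)))

/-- **Thorner–Zaman (Math. Z. 2024), Corollary 5, case "`(β₁,χ₁)` exists" (NAMED FACT, as
printed; Remark 6: `λ(x,q,a,x) = 1 − χ₁(a) x^{β₁−1}/β₁`).** There are absolute effective `c > 0`,
`K ≥ 0` such that for `q ≥ 2`, every exceptional pair `(β₁,χ₁)` mod `q`, `(a,q) = 1`, `x ≥ 3` with
`λx/φ(q) ≥ x^{18/19}`, `λ = 1 − χ₁(a)x^{β₁−1}/β₁`: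
`|∑_{p≤x, p≡a} log p − λx/φ(q)| ≤ K (λx/φ(q)) (exp(−c log x/log q) + exp(−c (log x)^{3/5}(log log x)^{−1/5}))`.
Not proved here. VERSION NOTE as for `thornerZaman2024PNTAP_corollary5_regular` (arXiv v1
hypothesis; arXiv v2: `x ≥ q^{12}`).
[cite: ThornerZaman2024PNTAP, Corollary 5 and Remark 6 p.4 (arXiv v1); arXiv v2, Corollary and Remark (long intervals)] -/
def thornerZaman2024PNTAP_corollary5_exceptional : Prop :=
  ∃ c : ℝ, 0 < c ∧ ∃ K : ℝ, 0 ≤ K ∧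
    ∀ (q : ℕ) [NeZero q], 2 ≤ q → ∀ (χ₁ : DirichletCharacter ℂ q) (β₁ : ℝ), ExceptionalPair χ₁ β₁ →
      ∀ (a : ZMod q), IsUnit a → ∀ x : ℝ, 3 ≤ x →
        x ^ ((18 : ℝ) / 19) ≤ (1 - (χ₁ a).re * x ^ (β₁ - 1) / β₁) * x / Nat.totient q →
          |thetaShortAP q a x x - (1 - (χ₁ a).re * x ^ (β₁ - 1) / β₁) * x / Nat.totient q| ≤
            K * ((1 - (χ₁ a).re * x ^ (β₁ - 1) / β₁) * x / Nat.totient q) *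
              (Real.exp (-c * Real.log x / Real.log q) +
                Real.exp (-c * Real.log x ^ ((3 : ℝ) / 5) / Real.log (Real.log x) ^ ((1 : ℝ) / 5)))

/-! ### Elementary bookkeeping (proved) -/

/-- `ν(u) ≤ 1` (unfolding the printed `ν(u) = min{1,(1−β₁)log u}`).
[cite: ThornerZaman2024PNTAP, Theorem 7 (definition of ν) p.6] -/
theorem ThornerZaman2024PNTAP.nu_le_one (β₁ u : ℝ) : nu β₁ u ≤ 1 :=
  min_le_left _ _

/-- `0 ≤ ν(u)` for `β₁ ≤ 1` and `u ≥ 1` (unfolding the printed `ν(u) = min{1,(1−β₁)log u}`).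
[cite: ThornerZaman2024PNTAP, Theorem 7 (definition of ν) p.6] -/
theorem ThornerZaman2024PNTAP.nu_nonneg {β₁ u : ℝ} (hβ : β₁ ≤ 1) (hu : 1 ≤ u) : 0 ≤ nu β₁ u :=
  le_min zero_le_one (mul_nonneg (sub_nonneg.mpr hβ) (Real.log_nonneg hu))

/-- Removing the exceptional zero can only decrease a finite count: `N*_{χ₁}(σ,T) ≤ N_{χ₁}(σ,T)`
whenever the printed zero set is finite (unfolding the printed `N_χ`, `N*_{χ₁}`).
[cite: ThornerZaman2024PNTAP, §2 (displays defining N_χ(σ,T), N*_{χ₁}(σ,T)) p.6] -/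
theorem ThornerZaman2024PNTAP.charZeroCountGeExcl_le {q : ℕ} [NeZero q] (χ₁ : DirichletCharacter ℂ q)
    (β₁ σ T : ℝ) (hfin : (zeroSetGe χ₁ σ T).Finite) :
    charZeroCountGeExcl χ₁ β₁ σ T ≤ charZeroCountGe χ₁ σ T :=
  Set.ncard_le_ncard Set.sdiff_subset hfin

/-- The repulsive bound is at most the same power without the factor `ν ≤ 1` (for a nonnegative
constant and base): the second part of Theorem 7 is never weaker in shape than a plain log-free
estimate with exponent `75/4` (unfolding `ν ≤ 1`). [cite: ThornerZaman2024PNTAP, Theorem 7 p.6] -/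
theorem ThornerZaman2024PNTAP.repulsive_rhs_le {C β₁ u e : ℝ} (hC : 0 ≤ C) (hu : 0 ≤ u) :
    C * nu β₁ u * u ^ e ≤ C * u ^ e := by
  have h1 : nu β₁ u ≤ 1 := nu_le_one β₁ u
  have hpow : 0 ≤ u ^ e := Real.rpow_nonneg hu e
  calc C * nu β₁ u * u ^ e = (C * u ^ e) * nu β₁ u := by ring
    _ ≤ (C * u ^ e) * 1 := by
        exact mul_le_mul_of_nonneg_left h1 (mul_nonneg hC hpow)
    _ = C * u ^ e := by ring

end Literature.NumberTheory.LFunctions
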